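import Literature.Topology.FourManifolds.EuclideanBoundaryCollarFlow
import Mathlib.Analysis.Calculus.LocalExtr.Basic

/-!
# The clock of the endgame outside the domain: a signed Lagrange multiplier on `∂D` and a
# compact regular band

Topic `Geometry/Riemannian` (fact seat
`provefact-Literature.Geometry.Riemannian.LawsonMichelsohn1984_surrounding`).  Everything here
is **proved**; no definitions.

The endgame (`MeanConvexSurroundingEndgame.lean`) needs a smooth clock `g` on `ℝ^{m+1}` with
`{g = 1} = ∂D = {F = 0}`, regular on a *compact* band `{lo' ≤ g ≤ hi'}`, `hi' > 1`.  The Morse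
theory of the domain `D = {F ≤ 0}` supplies (after Seeley extension) a smooth `g` with `g = 1`
on `∂D`, `g < 1` inside, `dg ≠ 0` on `∂D`, regular on `D ∩ {g ≥ lo'}` — but says nothing outside
`D`.  This file supplies the outside:

* `exists_pos_fderiv_eq_smul` — **signed Lagrange multiplier**: if `g = 1` on `{F = 0}`,
  `g ≤ 1` on `{F ≤ 0}` and `dg ≠ 0` on `{F = 0}`, then `dg = λ dF` with `λ > 0` along `{F = 0}`
  (the tangential part of `dg` vanishes — differentiate `g ≡ 1` along curves projected to the
  hypersurface by the gradient collar flow of `F` — and the normal part is `≥ 0` by the one-sided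
  Fermat principle along the flow lines, `IsLocalMaxOn.hasFDerivWithinAt_nonpos`);
* `exists_compactBand_clock` — **the compact regular band**: if moreover `g < 1` on `{F < 0}`
  and `dg ≠ 0` on `D ∩ {g ≥ lo}`, then `g` agrees on an open neighbourhood of `D` with a `C^∞`
  function `ĝ` whose band `{lo ≤ ĝ ≤ hi'}` (`hi' > 1`) is compact and free of critical points,
  with `{ĝ ≤ 1} ⊆ D` and `{ĝ = 1} = {F = 0}` (push `∂D` outward along the gradient collar of `F`
  for a short time — `g` grows at rate `≥ κ > 0` there — and cut off: `ĝ = 2 + ψ_R χ₀(F) (g - 2)`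
  with a spatial plateau `ψ_R` and a step `χ₀` in `F`, all constants chosen by compactness).

## References

* H. B. Lawson, Jr., M.-L. Michelsohn, *Embedding and surrounding with positive mean curvature*,
  Invent. Math. 77 (1984), proof of Thm. 6.1. [LawsonMichelsohn1984]
* J. Milnor, *Morse theory* (1963), §3. [Milnor1963]
-/

noncomputable section

open Set Function Filter Metric
open scoped Topology ContDiff

namespace Literature.Geometry.Riemannian

open Literature.Topology.FourManifolds

variable {E : Type*} [NormedAddCommGroup E] [InnerProductSpace ℝ E] [FiniteDimensional ℝ E]

/-- **Signed Lagrange multiplier on the boundary of a compact regular domain.**  Let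
`D = {F ≤ 0}` be compact with `dF ≠ 0` on `{F = 0}`, and let `g` be `C^∞` with `g = 1` on
`{F = 0}`, `g ≤ 1` on `D` and `dg ≠ 0` on `{F = 0}`.  Then at every point of `{F = 0}`,
`dg = λ dF` with `λ > 0`. [folklore] -/
theorem exists_pos_fderiv_eq_smul {F g : E → ℝ} (hF : ContDiff ℝ ∞ F)
    (hD : IsCompact {x | F x ≤ 0}) (hreg : ∀ x, F x = 0 → fderiv ℝ F x ≠ 0)
    (hg : ContDiff ℝ ∞ g) (hg1 : ∀ x, F x = 0 → g x = 1) (hgle : ∀ x, F x ≤ 0 → g x ≤ 1)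
    (hgreg : ∀ x, F x = 0 → fderiv ℝ g x ≠ 0) {x : E} (hx : F x = 0) :
    ∃ c : ℝ, 0 < c ∧ fderiv ℝ g x = c • fderiv ℝ F x := by
  obtain ⟨η₀, θ, O, hη₀, hθc, hθ0, -, -, -, -, hOo, hZO, -, hclock, -, -, -, -⟩ :=
    exists_gradientCollarFlow hF hD hreg
  have hxO : x ∈ O := hZO hx
  have hFd : Differentiable ℝ F := hF.differentiable (by simp)
  have hgd : Differentiable ℝ g := hg.differentiable (by simp)
  -- the flow line through `x` and its velocity `γ'`
  set γ : ℝ → E := fun s => θ x s with hγ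
  have hγc : ContDiff ℝ ∞ γ := hθc.comp (contDiff_const.prodMk contDiff_id)
  have hγd : Differentiable ℝ γ := hγc.differentiable (by simp)
  set γ' : E := deriv γ 0 with hγ'
  have hγ0 : γ 0 = x := hθ0 x
  have hγder : HasDerivAt γ γ' 0 := (hγd 0).hasDerivAt
  -- the clock: `F (γ s) = s` for `|s| ≤ 4η₀`
  have hFγ : ∀ s ∈ Icc (-(4 * η₀)) (4 * η₀), F (γ s) = s := fun s hs => by
    rw [hγ]; dsimp only; rw [hclock x hxO s hs, hx, zero_add]
  have hI : Ioo (-(4 * η₀)) (4 * η₀) ∈ 𝓝 (0 : ℝ) :=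
    isOpen_Ioo.mem_nhds ⟨by linarith, by linarith⟩
  -- (i) `dF(x) γ' = 1`
  have h1 : fderiv ℝ F x γ' = 1 := by
    have hcomp : HasDerivAt (fun s => F (γ s)) (fderiv ℝ F x γ') 0 := by
      have := (hFd (γ 0)).hasFDerivAt.comp_hasDerivAt (0 : ℝ) hγder
      rwa [hγ0] at this
    have hid : HasDerivAt (fun s => F (γ s)) 1 0 := by
      refine (hasDerivAt_id (0 : ℝ)).congr_of_eventuallyEq ?_
      filter_upwards [hI] with s hs
      exact hFγ s (Ioo_subset_Icc_self hs)
    exact hcomp.unique hid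
  -- (ii) `dg(x) γ' ≥ 0`: one-sided Fermat along the flow line
  have h2 : 0 ≤ fderiv ℝ g x γ' := by
    have hφ : HasDerivAt (fun s => g (γ s)) (fderiv ℝ g x γ') 0 := by
      have := (hgd (γ 0)).hasFDerivAt.comp_hasDerivAt (0 : ℝ) hγder
      rwa [hγ0] at this
    have hmax : IsLocalMaxOn (fun s => g (γ s)) (Iic 0) 0 := by
      refine Filter.eventually_of_mem (inter_mem_nhdsWithin (Iic (0 : ℝ)) hI) ?_
      rintro s ⟨hs, hs0⟩
      have hs' : s ≤ 0 := hs
      show g (γ s) ≤ g (γ 0)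
      rw [hγ0, hg1 x hx]
      exact hgle _ (by rw [hFγ s (Ioo_subset_Icc_self hs0)]; exact hs')
    have hcone : (-1 : ℝ) ∈ posTangentConeAt (Iic (0 : ℝ)) 0 :=
      mem_posTangentConeAt_of_segment_subset
        ((convex_Iic (0 : ℝ)).segment_subset (by simp) (by norm_num))
    have h := hmax.hasFDerivWithinAt_nonpos hφ.hasFDerivAt.hasFDerivWithinAt hcone
    have h' : -(fderiv ℝ g x γ') ≤ 0 := by simpa using h
    linarith
  -- (iii) `ker dF(x) ⊆ ker dg(x)`: differentiate `g ≡ 1` along a projected curve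
  have h3 : ∀ w : E, fderiv ℝ F x w = 0 → fderiv ℝ g x w = 0 := by
    intro w hw
    -- the joint flow and its derivative at `(x, 0)`
    set Θ : E × ℝ → E := fun p => θ p.1 p.2 with hΘ
    have hΘd : Differentiable ℝ Θ := hθc.differentiable (by simp)
    set L := fderiv ℝ Θ (x, 0) with hL
    have hLΘ : HasFDerivAt Θ L (x, 0) := (hΘd (x, 0)).hasFDerivAt
    -- `L (w, 0) = w`, from `Θ (z, 0) = z`
    have hLw : L (w, 0) = w := by
      have hprod : HasFDerivAt (fun z : E => (z, (0 : ℝ)))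
          ((ContinuousLinearMap.id ℝ E).prod (0 : E →L[ℝ] ℝ)) x :=
        (hasFDerivAt_id x).prodMk (hasFDerivAt_const (0 : ℝ) x)
      have ha : HasFDerivAt (Θ ∘ fun z : E => (z, (0 : ℝ)))
          (L.comp ((ContinuousLinearMap.id ℝ E).prod (0 : E →L[ℝ] ℝ))) x :=
        HasFDerivAt.comp x hLΘ hprod
      have hb : HasFDerivAt (id : E → E)
          (L.comp ((ContinuousLinearMap.id ℝ E).prod (0 : E →L[ℝ] ℝ))) x :=
        ha.congr_of_eventuallyEq (Filter.Eventually.of_forall fun z => (hθ0 z).symm)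
      have := congrArg (fun T : E →L[ℝ] E => T w) ((hasFDerivAt_id x).unique hb)
      simpa using this.symm
    -- the curve `c t = θ (x + t w) (-F (x + t w))`, projected to `{F = 0}`
    set ℓ : ℝ → E × ℝ := fun t => (x + t • w, -F (x + t • w)) with hℓ
    have hℓd : HasDerivAt ℓ (w, -(fderiv ℝ F x w)) 0 := by
      have ha : HasDerivAt (fun t : ℝ => x + t • w) w 0 := by
        simpa using ((hasDerivAt_id (0 : ℝ)).smul_const w).const_add x
      have hb : HasDerivAt (fun t : ℝ => -F (x + t • w)) (-(fderiv ℝ F x w)) 0 := by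
        have := (hFd (x + (0 : ℝ) • w)).hasFDerivAt.comp_hasDerivAt (0 : ℝ) ha
        simp only [zero_smul, add_zero] at this
        exact this.neg
      exact ha.prodMk hb
    have hℓ0 : ℓ 0 = (x, 0) := by simp [hℓ, hx]
    have hLΘ' : HasFDerivAt Θ L (ℓ 0) := by rw [hℓ0]; exact hLΘ
    have hc : HasDerivAt (fun t => Θ (ℓ t)) (L (w, -(fderiv ℝ F x w))) 0 :=
      hLΘ'.comp_hasDerivAt (0 : ℝ) hℓd
    rw [hw, neg_zero, hLw] at hc
    -- `g (Θ (ℓ t)) = 1` near `t = 0`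
    have hev : ∀ᶠ t in 𝓝 (0 : ℝ), g (Θ (ℓ t)) = 1 := by
      have hcont : Continuous fun t : ℝ => x + t • w := by fun_prop
      have hO' : ∀ᶠ t in 𝓝 (0 : ℝ), x + t • w ∈ O := by
        refine hcont.continuousAt.preimage_mem_nhds ?_
        simpa using hOo.mem_nhds hxO
      have hF' : ∀ᶠ t in 𝓝 (0 : ℝ), F (x + t • w) ∈ Ioo (-(4 * η₀)) (4 * η₀) := by
        refine (hF.continuous.comp hcont).continuousAt.preimage_mem_nhds ?_
        simp only [comp_apply, zero_smul, add_zero, hx]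
        exact hI
      filter_upwards [hO', hF'] with t htO htF
      apply hg1
      show F (θ (x + t • w) (-F (x + t • w))) = 0
      rw [hclock _ htO _ ⟨by linarith [htF.2], by linarith [htF.1]⟩, add_neg_cancel]
    have hconst : HasDerivAt (fun t => g (Θ (ℓ t))) 0 0 :=
      (hasDerivAt_const (0 : ℝ) (1 : ℝ)).congr_of_eventuallyEq hev
    have hchain : HasDerivAt (fun t => g (Θ (ℓ t))) (fderiv ℝ g x w) 0 := by
      have hgx : HasFDerivAt g (fderiv ℝ g x) (Θ (ℓ 0)) := by
        rw [hℓ0]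
        show HasFDerivAt g (fderiv ℝ g x) (θ x 0)
        rw [hθ0]; exact (hgd x).hasFDerivAt
      exact hgx.comp_hasDerivAt (0 : ℝ) hc
    exact hchain.unique hconst
  -- (iv) assemble: `dg = (dg γ') dF`
  refine ⟨fderiv ℝ g x γ', ?_, ?_⟩
  · rcases h2.lt_or_eq with hlt | heq
    · exact hlt
    · exfalso
      apply hgreg x hx
      ext u
      have hu : fderiv ℝ F x (u - fderiv ℝ F x u • γ') = 0 := by
        rw [map_sub, map_smul, h1, smul_eq_mul, mul_one, sub_self]
      have := h3 _ hu
      rw [map_sub, map_smul, ← heq, smul_zero, sub_zero] at this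
      simpa using this
  · ext u
    have hu : fderiv ℝ F x (u - fderiv ℝ F x u • γ') = 0 := by
      rw [map_sub, map_smul, h1, smul_eq_mul, mul_one, sub_self]
    have := h3 _ hu
    rw [map_sub, map_smul, smul_eq_mul, sub_eq_zero] at this
    rw [smul_apply, smul_eq_mul, this, mul_comm]

/-- A continuous function positive on a compact set is bounded below there by a positive
constant. [folklore] -/
private theorem exists_pos_le_on_isCompact {X : Type*} [TopologicalSpace X] {F : X → ℝ}
    (hF : Continuous F) {K : Set X} (hK : IsCompact K) (hpos : ∀ z ∈ K, 0 < F z) :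
    ∃ c : ℝ, 0 < c ∧ ∀ z ∈ K, c ≤ F z := by
  rcases K.eq_empty_or_nonempty with hKe | hKne
  · exact ⟨1, one_pos, fun z hz => by rw [hKe] at hz; exact hz.elim⟩
  · obtain ⟨z₀, hz₀, hmin⟩ := hK.exists_isMinOn hKne hF.continuousOn
    exact ⟨F z₀, hpos z₀ hz₀, fun z hz => hmin hz⟩

/-- **A compact regular band for the clock.**  Let `D = {F ≤ 0}` be compact with `dF ≠ 0` on
`{F = 0}`, and let `g` be `C^∞` with `g = 1` on `{F = 0}`, `g < 1` on `{F < 0}`,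
`dg ≠ 0` on `{F = 0}` and on `D ∩ {g ≥ lo}`.  Then `g` can be modified off an open neighbourhood
of `D` to a `C^∞` function `ĝ` with a **compact** band `{lo ≤ ĝ ≤ hi'}`, `hi' > 1`, free of
critical points, such that `{ĝ ≤ 1} = D` and `{ĝ = 1} = {F = 0}` (push `∂D` outward along the
gradient collar of `F`, where `dg` is a positive multiple of `dF`, and cut off far away).
[folklore] -/
theorem exists_compactBand_clock {F g : E → ℝ} (hF : ContDiff ℝ ∞ F)
    (hD : IsCompact {x | F x ≤ 0}) (hreg : ∀ x, F x = 0 → fderiv ℝ F x ≠ 0)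
    (hg : ContDiff ℝ ∞ g) (hg1 : ∀ x, F x = 0 → g x = 1)
    (hglt : ∀ x, F x < 0 → g x < 1) (hgreg : ∀ x, F x = 0 → fderiv ℝ g x ≠ 0) {lo : ℝ}
    (hin : ∀ x, F x ≤ 0 → lo ≤ g x → fderiv ℝ g x ≠ 0) :
    ∃ (ĝ : E → ℝ) (hi' : ℝ), ContDiff ℝ ∞ ĝ ∧ 1 < hi' ∧
      (∃ U : Set E, IsOpen U ∧ {x | F x ≤ 0} ⊆ U ∧ ∀ x ∈ U, ĝ x = g x) ∧
      IsCompact {x | ĝ x ∈ Icc lo hi'} ∧ (∀ x, ĝ x ∈ Icc lo hi' → fderiv ℝ ĝ x ≠ 0) ∧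
      (∀ x, ĝ x ≤ 1 → F x ≤ 0) ∧ (∀ x, ĝ x = 1 ↔ F x = 0) := by
  have hgle : ∀ x, F x ≤ 0 → g x ≤ 1 := fun x hx => by
    rcases hx.lt_or_eq with h | h
    · exact (hglt x h).le
    · exact (hg1 x h).le
  obtain ⟨η₀, θ, O, hη₀, hθc, hθ0, hadd, -, -, -, hOo, hZO, -, hclock, -, -, -, -⟩ :=
    exists_gradientCollarFlow hF hD hreg
  have hFd : Differentiable ℝ F := hF.differentiable (by simp)
  have hgd : Differentiable ℝ g := hg.differentiable (by simp)
  set Θ : E × ℝ → E := fun p => θ p.1 p.2 with hΘ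
  have hΘd : Differentiable ℝ Θ := hθc.differentiable (by simp)
  -- the velocity field of the flow
  set V : E → E := fun z => fderiv ℝ Θ (z, 0) (0, 1) with hV
  have hVc : Continuous V := by
    have h1 : Continuous fun z : E => fderiv ℝ Θ (z, 0) :=
      (hθc.continuous_fderiv (by simp)).comp (continuous_id.prodMk continuous_const)
    exact h1.clm_apply continuous_const
  -- `∂ₛ θ (z, s) = V (θ z s)` (group law)
  have hderiv : ∀ z s, HasDerivAt (fun t => θ z t) (V (θ z s)) s := by
    intro z s
    have hprod : HasDerivAt (fun t : ℝ => (θ z s, t)) ((0 : E), (1 : ℝ)) (s - s) :=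
      (hasDerivAt_const (s - s) (θ z s)).prodMk (hasDerivAt_id (s - s))
    have h1 : HasDerivAt (fun t : ℝ => Θ (θ z s, t)) (V (θ z s)) (s - s) := by
      have h := (hΘd (θ z s, s - s)).hasFDerivAt.comp_hasDerivAt (s - s) hprod
      rw [sub_self] at h ⊢
      exact h
    have hsub : HasDerivAt (fun t : ℝ => t - s) 1 s := (hasDerivAt_id s).sub_const s
    have h2 := HasDerivAt.scomp (h := fun t : ℝ => t - s) s h1 hsub
    rw [one_smul] at h2
    have heq : ((fun t : ℝ => Θ (θ z s, t)) ∘ fun t => t - s) = fun t => θ z t := by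
      funext t
      show θ (θ z s) (t - s) = θ z t
      rw [← hadd, add_sub_cancel]
    rwa [heq] at h2
  -- `dF(V) = 1` on `O`
  have hdFV : ∀ z ∈ O, fderiv ℝ F z (V z) = 1 := by
    intro z hz
    have hI : Ioo (-(4 * η₀)) (4 * η₀) ∈ 𝓝 (0 : ℝ) :=
      isOpen_Ioo.mem_nhds ⟨by linarith, by linarith⟩
    have hcomp : HasDerivAt (fun s => F (θ z s)) (fderiv ℝ F z (V z)) 0 := by
      have h := (hFd (θ z 0)).hasFDerivAt.comp_hasDerivAt (0 : ℝ) (hderiv z 0)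
      rwa [hθ0] at h
    have hid : HasDerivAt (fun s => F (θ z s)) 1 0 := by
      have h' : HasDerivAt (fun s : ℝ => F z + s) 1 0 := (hasDerivAt_id (0 : ℝ)).const_add (F z)
      refine h'.congr_of_eventuallyEq ?_
      filter_upwards [hI] with s hs
      exact hclock z hz s (Ioo_subset_Icc_self hs)
    exact hcomp.unique hid
  -- `ψ = dg(V)` is continuous and positive on `{F = 0}`
  set ψ : E → ℝ := fun z => fderiv ℝ g z (V z) with hψ
  have hψc : Continuous ψ :=
    (hg.continuous_fderiv (by simp)).clm_apply hVc
  have hψpos : ∀ x, F x = 0 → 0 < ψ x := by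
    intro x hx
    obtain ⟨c, hc, hcx⟩ := exists_pos_fderiv_eq_smul hF hD hreg hg hg1 hgle hgreg hx
    show 0 < fderiv ℝ g x (V x)
    rw [hcx, smul_apply, hdFV x (hZO hx), smul_eq_mul, mul_one]
    exact hc
  have hZc : IsCompact {x : E | F x = 0} :=
    hD.of_isClosed_subset (isClosed_eq hF.continuous continuous_const) fun x hx => le_of_eq hx
  obtain ⟨κ2, hκ2, hκ2Z⟩ := exists_pos_le_on_isCompact hψc hZc fun z hz => hψpos z hz
  set κ : ℝ := κ2 / 2 with hκ
  have hκpos : 0 < κ := by positivity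
  -- the open set where `ψ > κ`, and a uniform time `ε` keeping `Z`-tracks inside it and `O`
  set U : Set E := {z | κ < ψ z} ∩ O with hU
  have hUo : IsOpen U := (isOpen_lt continuous_const hψc).inter hOo
  have hZU : ∀ x, F x = 0 → x ∈ U := fun x hx =>
    ⟨by show κ < ψ x; have := hκ2Z x hx; rw [hκ]; linarith, hZO hx⟩
  have hev : ∀ᶠ s in 𝓝 (0 : ℝ), ∀ x ∈ {x : E | F x = 0}, θ x s ∈ U := by
    refine hZc.eventually_forall_of_forall_eventually fun x hx => ?_
    have hcont : Continuous fun q : ℝ × E => θ q.2 q.1 :=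
      hθc.continuous.comp (continuous_snd.prodMk continuous_fst)
    have : (fun q : ℝ × E => θ q.2 q.1) ⁻¹' U ∈ 𝓝 ((0 : ℝ), x) := by
      refine hcont.continuousAt.preimage_mem_nhds ?_
      show U ∈ 𝓝 (θ x 0)
      rw [hθ0]; exact hUo.mem_nhds (hZU x hx)
    exact this
  obtain ⟨ε₁, hε₁, hε₁U⟩ : ∃ ε₁ > (0 : ℝ), ∀ s, |s| < ε₁ → ∀ x, F x = 0 → θ x s ∈ U := by
    obtain ⟨r, hr, hrU⟩ := Metric.mem_nhds_iff.1 hev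
    exact ⟨r, hr, fun s hs x hx => hrU (by simpa [Real.dist_eq] using hs) x hx⟩
  set ε : ℝ := min (ε₁ / 2) η₀ with hε
  have hεpos : 0 < ε := lt_min (by positivity) hη₀
  have hεε₁ : ε < ε₁ := (min_le_left _ _).trans_lt (by linarith)
  have hεη : ε ≤ η₀ := min_le_right _ _
  have htrackU : ∀ x, F x = 0 → ∀ s ∈ Icc (-ε) ε, θ x s ∈ U := fun x hx s hs =>
    hε₁U s (abs_lt.2 ⟨by linarith [hs.1], by linarith [hs.2]⟩) x hx
  -- outward estimate: `g (θ x s) ≥ 1 + κ s` for `x ∈ Z`, `0 ≤ s ≤ ε`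
  have hout : ∀ x, F x = 0 → ∀ s ∈ Icc 0 ε, 1 + κ * s ≤ g (θ x s) := by
    intro x hx s hs
    have hd : ∀ t, HasDerivAt (fun u => g (θ x u)) (ψ (θ x t)) t := fun t =>
      (hgd (θ x t)).hasFDerivAt.comp_hasDerivAt t (hderiv x t)
    have key := (convex_Icc (0 : ℝ) ε).mul_sub_le_image_sub_of_le_deriv
      (f := fun u => g (θ x u)) (fun t _ => (hd t).continuousAt.continuousWithinAt)
      (fun t _ => (hd t).differentiableAt.differentiableWithinAt) (C := κ)
      (fun t ht => by
        rw [interior_Icc] at ht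
        rw [(hd t).deriv]
        exact (htrackU x hx t ⟨by linarith [ht.1], ht.2.le⟩).1.le)
      0 (left_mem_Icc.2 hεpos.le) s hs hs.1
    simp only [sub_zero, hθ0, hg1 x hx] at key
    linarith
  have houtreg : ∀ x, F x = 0 → ∀ s ∈ Icc 0 ε, fderiv ℝ g (θ x s) ≠ 0 := by
    intro x hx s hs h0
    have := (htrackU x hx s ⟨by linarith [hs.1], hs.2⟩).1
    have h' : ψ (θ x s) = 0 := by show fderiv ℝ g (θ x s) (V (θ x s)) = 0; rw [h0]; rfl
    simp only [mem_setOf_eq, h'] at this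
    linarith
  -- radii: a closed ball `K` containing `D` and the outer tracks, with a plateau `ψR`
  set B : Set E := Θ '' ({x : E | F x = 0} ×ˢ Icc 0 ε) with hB
  have hBc : IsCompact B := (hZc.prod isCompact_Icc).image hΘd.continuous
  obtain ⟨R, hR⟩ : ∃ R : ℝ, {x : E | F x ≤ 0} ∪ B ⊆ ball (0 : E) R :=
    (hD.union hBc).isBounded.subset_ball 0
  set K : Set E := closedBall (0 : E) R with hK
  have hKc : IsCompact K := isCompact_closedBall 0 R
  have hDK : {x : E | F x ≤ 0} ⊆ ball 0 R := subset_union_left.trans hR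
  obtain ⟨δ, ψR, hδ, hsubR, hψRc, hψR01, hψR1, hψRcs, hψRsupp⟩ :=
    exists_contDiff_plateau_cthickening hKc isOpen_univ (subset_univ K)
  -- lower bounds for `F` on the transition annulus and off `D ∪ O` inside the big region
  set A : Set E := cthickening (2 * δ) K \ thickening δ K with hA
  have hAc : IsCompact A := hKc.cthickening.diff isOpen_thickening
  have hFA : ∀ z ∈ A, 0 < F z := by
    rintro z ⟨-, hz⟩
    by_contra h
    exact hz (self_subset_thickening hδ K (ball_subset_closedBall (hDK (not_lt.1 h))))
  obtain ⟨cA, hcA, hcAF⟩ := exists_pos_le_on_isCompact hF.continuous hAc hFA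
  set KB : Set E := cthickening (2 * δ) K \ ({x | F x < 0} ∪ O) with hKB
  have hKBc : IsCompact KB :=
    hKc.cthickening.diff ((isOpen_lt hF.continuous continuous_const).union hOo)
  have hFKB : ∀ z ∈ KB, 0 < F z := by
    rintro z ⟨-, hz⟩
    rw [mem_union, not_or] at hz
    rcases lt_trichotomy (F z) 0 with h | h | h
    · exact (hz.1 h).elim
    · exact (hz.2 (hZO h)).elim
    · exact h
  obtain ⟨cB, hcB, hcBF⟩ := exists_pos_le_on_isCompact hF.continuous hKBc hFKB
  -- the final small parameter `ε'`
  set ε' : ℝ := min (min ε (4 * η₀)) (min (min cA cB / 2) (1 / κ)) with hε'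
  have hε'pos : 0 < ε' := by positivity
  have hε'ε : ε' ≤ ε := (min_le_left _ _).trans (min_le_left _ _)
  have hε'η : ε' ≤ 4 * η₀ := (min_le_left _ _).trans (min_le_right _ _)
  have hε'A : ε' < cA := by
    have : ε' ≤ min cA cB / 2 := (min_le_right _ _).trans (min_le_left _ _)
    have := min_le_left cA cB; linarith
  have hε'B : ε' < cB := by
    have : ε' ≤ min cA cB / 2 := (min_le_right _ _).trans (min_le_left _ _)
    have := min_le_right cA cB; linarith
  have hε'κ : κ * ε' ≤ 1 := by
    have : ε' ≤ 1 / κ := (min_le_right _ _).trans (min_le_right _ _)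
    rwa [le_div_iff₀' hκpos] at this
  -- the cut-off in the `F`-direction
  set χ₀ : ℝ → ℝ := fun t => Real.smoothTransition ((ε' - t) / (ε' / 2)) with hχ₀
  have hχ₀c : ContDiff ℝ ∞ χ₀ :=
    Real.smoothTransition.contDiff.comp ((contDiff_const.sub contDiff_id).div_const _)
  have hχ₀one : ∀ t, t ≤ ε' / 2 → χ₀ t = 1 := fun t ht =>
    Real.smoothTransition.one_of_one_le (by rw [le_div_iff₀ (by positivity)]; linarith)
  have hχ₀zero : ∀ t, ε' ≤ t → χ₀ t = 0 := fun t ht =>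
    Real.smoothTransition.zero_of_nonpos (div_nonpos_of_nonpos_of_nonneg (by linarith) (by positivity))
  have hχ₀01 : ∀ t, χ₀ t ∈ Icc (0 : ℝ) 1 := fun t =>
    ⟨Real.smoothTransition.nonneg _, Real.smoothTransition.le_one _⟩
  have hχ₀pos : ∀ t, 0 < χ₀ t → t < ε' := fun t ht => by
    by_contra h; rw [not_lt] at h; rw [hχ₀zero t h] at ht; exact lt_irrefl _ ht
  -- the modified clock
  set ĝ : E → ℝ := fun z => 2 + ψR z * χ₀ (F z) * (g z - 2) with hĝ
  have hĝc : ContDiff ℝ ∞ ĝ :=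
    contDiff_const.add ((hψRc.mul (hχ₀c.comp hF)).mul (hg.sub contDiff_const))
  -- the neighbourhood of `D` where `ĝ = g`
  set U₁ : Set E := thickening δ K ∩ {z | F z < ε' / 2} with hU₁
  have hU₁o : IsOpen U₁ := isOpen_thickening.inter (isOpen_lt hF.continuous continuous_const)
  have hDU₁ : {x : E | F x ≤ 0} ⊆ U₁ := fun z hz =>
    ⟨self_subset_thickening hδ K (ball_subset_closedBall (hDK hz)), by
      show F z < ε' / 2; have : F z ≤ 0 := hz; linarith⟩
  have hĝU₁ : ∀ z ∈ U₁, ĝ z = g z := by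
    rintro z ⟨hz1, hz2⟩
    have h1 : ψR z = 1 := hψR1 z (thickening_subset_cthickening δ K hz1)
    have h2 : χ₀ (F z) = 1 := hχ₀one _ (le_of_lt hz2)
    simp only [hĝ, h1, h2]; ring
  -- the structure of `{ĝ ≤ hi'}`
  set hi' : ℝ := 1 + κ * ε' / 4 with hhi'
  have hhi'1 : 1 < hi' := by rw [hhi']; linarith [mul_pos hκpos hε'pos]
  have hhi'2 : hi' < 2 := by rw [hhi']; nlinarith
  -- points with `ĝ ≤ hi'` lie in `D`, or on a short outward track inside `U₁`
  have hstruct : ∀ z, ĝ z ≤ hi' → F z ≤ 0 ∨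
      (z ∈ U₁ ∧ fderiv ℝ g z ≠ 0 ∧ 1 < ĝ z) := by
    intro z hz
    have hprod : ψR z * χ₀ (F z) * (g z - 2) < 0 := by
      have : ĝ z = 2 + ψR z * χ₀ (F z) * (g z - 2) := rfl
      linarith
    have hψRpos : 0 < ψR z := by
      rcases (hψR01 z).1.lt_or_eq with h | h
      · exact h
      · rw [← h] at hprod; simp at hprod
    have hχpos : 0 < χ₀ (F z) := by
      rcases (hχ₀01 (F z)).1.lt_or_eq with h | h
      · exact h
      · rw [← h] at hprod; simp at hprod
    have hFz : F z < ε' := hχ₀pos _ hχpos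
    have hg2 : g z < 2 := by
      by_contra h
      rw [not_lt] at h
      have : 0 ≤ ψR z * χ₀ (F z) * (g z - 2) :=
        mul_nonneg (mul_nonneg hψRpos.le hχpos.le) (by linarith)
      linarith
    -- `z` lies in the support of `ψR`, hence in `cthickening (2δ) K`, and not in `A`
    have hz2δ : z ∈ cthickening (2 * δ) K :=
      hψRsupp (subset_tsupport _ (by show ψR z ≠ 0; exact hψRpos.ne'))
    have hzth : z ∈ thickening δ K := by
      by_contra h
      have := hcAF z ⟨hz2δ, h⟩
      linarith
    have hψR1z : ψR z = 1 := hψR1 z (thickening_subset_cthickening δ K hzth)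
    rcases le_or_gt (F z) 0 with hF0 | hF0
    · exact Or.inl hF0
    · right
      -- `z ∈ O` (else `z ∈ KB`)
      have hzO : z ∈ O := by
        by_contra h
        have hzKB : z ∈ KB := ⟨hz2δ, by
          rw [mem_union, not_or]; exact ⟨fun h' => absurd h' (not_lt.2 hF0.le), h⟩⟩
        have := hcBF z hzKB
        linarith
      -- project to `Z` along the flow
      set x₀ := θ z (-F z) with hx₀
      have hFz4 : -F z ∈ Icc (-(4 * η₀)) (4 * η₀) := ⟨by linarith, by linarith⟩
      have hx₀Z : F x₀ = 0 := by rw [hx₀, hclock z hzO _ hFz4, add_neg_cancel]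
      have hzx₀ : θ x₀ (F z) = z := by rw [hx₀, ← hadd, neg_add_cancel, hθ0]
      have hsI : F z ∈ Icc 0 ε := ⟨hF0.le, by linarith⟩
      have hgz : 1 + κ * F z ≤ g z := by have := hout x₀ hx₀Z (F z) hsI; rwa [hzx₀] at this
      have hgreg' : fderiv ℝ g z ≠ 0 := by have := houtreg x₀ hx₀Z (F z) hsI; rwa [hzx₀] at this
      -- `F z < ε'/2`, since otherwise `ĝ z > hi'`
      have hFz2 : F z < ε' / 2 := by
        by_contra h
        rw [not_lt] at h
        have hĝz : ĝ z = 2 + χ₀ (F z) * (g z - 2) := by simp only [hĝ, hψR1z, one_mul]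
        have : g z ≤ ĝ z := by
          rw [hĝz]
          nlinarith [(hχ₀01 (F z)).2, hg2]
        have : 1 + κ * (ε' / 2) ≤ g z := le_trans (by nlinarith) hgz
        linarith
      have hzU₁ : z ∈ U₁ := ⟨hzth, hFz2⟩
      refine ⟨hzU₁, hgreg', ?_⟩
      rw [hĝU₁ z hzU₁]
      nlinarith
  refine ⟨ĝ, hi', hĝc, hhi'1, ⟨U₁, hU₁o, hDU₁, hĝU₁⟩, ?_, ?_, ?_, ?_⟩
  · -- compactness of the band: closed and inside `cthickening (2δ) K`
    refine Metric.isCompact_of_isClosed_isBounded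
      (isClosed_Icc.preimage hĝc.continuous)
      ((hKc.cthickening (r := 2 * δ)).isBounded.subset ?_)
    intro z hz
    have hz' : ĝ z ≤ hi' := hz.2
    have hprod : ψR z * χ₀ (F z) * (g z - 2) < 0 := by
      have : ĝ z = 2 + ψR z * χ₀ (F z) * (g z - 2) := rfl
      linarith
    have hψRpos : ψR z ≠ 0 := by
      intro h; rw [h] at hprod; simp at hprod
    exact hψRsupp (subset_tsupport _ hψRpos)
  · -- no critical points on the band
    intro z hz h0
    have hfd : fderiv ℝ ĝ z = fderiv ℝ g z := by
      refine Filter.EventuallyEq.fderiv_eq ?_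
      rcases hstruct z hz.2 with h | h
      · exact (hU₁o.eventually_mem (hDU₁ h)).mono fun y hy => hĝU₁ y hy
      · exact (hU₁o.eventually_mem h.1).mono fun y hy => hĝU₁ y hy
    rw [hfd] at h0
    rcases hstruct z hz.2 with h | h
    · exact hin z h (by rw [← hĝU₁ z (hDU₁ h)]; exact hz.1) h0
    · exact h.2.1 h0
  · -- `{ĝ ≤ 1} ⊆ D`
    intro z hz
    rcases hstruct z (hz.trans hhi'1.le) with h | h
    · exact h
    · linarith [h.2.2]
  · -- `{ĝ = 1} = {F = 0}`
    intro z
    constructor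
    · intro hz
      have hF0 : F z ≤ 0 := by
        rcases hstruct z (by rw [hz]; exact hhi'1.le) with h | h
        · exact h
        · linarith [h.2.2]
      have hgz : g z = 1 := by rw [← hĝU₁ z (hDU₁ hF0)]; exact hz
      rcases hF0.lt_or_eq with h | h
      · exact absurd hgz (hglt z h).ne
      · exact h
    · intro hz
      rw [hĝU₁ z (hDU₁ (le_of_eq hz))]
      exact hg1 z hz

end Literature.Geometry.Riemannian

end
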